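import Literature.AlgebraicGeometry.HodgeTheory.NodalPencilFibreBridge
import Literature.AlgebraicGeometry.HodgeTheory.UniversalHypersurfaceTransportOfIsotopy
import Literature.Geometry.ComplexAnalytic.PhamBrieskornJoin
import Mathlib.Topology.Homotopy.Basic
import HarnessLib

/-!
# From the geometric monodromy of a monomial pencil on the regular locus to the LOCALISATION PACKAGE on the projective
# fibre: a monodromy homeomorphism `η` of `Y_s(ℂ)`, the identity on an open `B`, homotopy-conjugate on an open `A`
# through a chart to a self-map of a Pham–Brieskorn fibre, and equal to THE rational transport along the loop

Family `hodge`, layer `Literature/AlgebraicGeometry/HodgeTheory`; theorems only (no definition, no named fact). Written by the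
prover seat `hodge-nonav-20241-p1` (g19, cell `hodge-nonav`) as brick 7 of the port B4c of the programme «A₃-TRACE» (memo
`HOME/memos/PROGRAMME-A3-TRACE-Bx-g16.md` §3; binder hN `stub_a3NonComm` of crux K1-B `VeryGeneralSignCommutatorsInHg`,
`Summits/HodgeConjecture/HodgeConjecture/Theses/SignSymmetricPowers.lean`, stmt-HodgeConjecture-19716). It is the twin of prover-Bx's
`NodalPencilProjectiveIsotopy.exists_isPicardLefschetzData_one_of_pencilMonodromy` in which the Picard–Lefschetz socket is replaced by the
OUTPUT SHAPE «H-A3LOC» consumed by `SymmetricA3NonCommutationOfLocalisation.symmetricA3NonCommutation_of_localisedRotation` (and by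
`PhamBrieskornLocalisedMonodromyNotUnipotent.not_isNilpotent_sub_one_of_localisedRotation_fiberOver`).

Input (all weights `a`, any Pham–Brieskorn self-map `g`): the geometric monodromy `h, k : ℝ × S → S` of a pencil `b₀ + c·e_{xᵢ^d}` on
the pencil slice `S ⊆ 𝒴°(ℂ)` (`WeightedPencilMonodromyMap`: `h` continuous on `ℝ × {c ≠ 0}`, `h(0, ·) = id`, `c(h(u, x)) = e^{2πiu} c(x)`,
`k(u, ·)` the two-sided inverse with `c(k(u, x)) = e^{−2πiu} c(x)`) and a localisation datum on the member `X_c`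
(`WeightedPencilLocalisation`: open cover `A ∪ B`, a continuous `κ` reading `k(1, ·)`, equal to the identity on `B`, its restriction `κA`
to `A`, a chart `e : A → {Σ zⱼ^{aⱼ} = 1}`, a self-map `g` of that fibre and a homotopy `e ∘ κA ≃ g ∘ e`), for a loop `γ` of `U(ℂ)` at a
point `s` with `b(s) = b₀ + c·e`, `b(γ u) = b₀ + e^{2πiu}c·e`.

Output (`exists_localisationPackage_of_pencilMonodromy`): opens `A', B'` of `Y_s(ℂ)` with `A' ∪ B' = Y_s(ℂ)`, a homeomorphism `η` of
`Y_s(ℂ)` equal to the identity on `B'` and mapping `A'` to itself (restriction `ηA`), a homeomorphism `r : A' ≃ₜ A` with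
`(e ∘ r) ∘ ηA ≃ g ∘ (e ∘ r)`, and: **for every cohomological trivialisation datum `hU`, every degree `k'` and every rational transport
`T` of `Rᵏ' π_* ℚ` along `γ`, `T = η^*`**. Construction: `η = σ⁻¹ ∘ κ ∘ σ` for the homeomorphism `σ : Y_s(ℂ) ≃ₜ X_c` of
`UniversalHypersurfaceFibreCoordinates` + `NodalPencilFibreBridge`; the projective isotopy `h_u [z] = [h(u, σ_s[z])]` feeds
`UniversalHypersurfaceTransportOfIsotopy.exists_homeomorph_isRatTransport_of_isotopy`, whose monodromy homeomorphism has inverse reading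
`k(1, ·)`, hence equal to `η` (injectivity of `fibrePoint`); rational transports along a path class are unique (`ofRatClass_injective`).

Everything is proved; no definitions, no named facts. Honest scope: plumbing of the classical construction of the geometric monodromy of a
pencil near an isolated weighted-homogeneous singular point; nothing here says HC or any rung is proved.

## References

* [VoisinHodgeII2003] C. Voisin, Hodge Theory and Complex Algebraic Geometry II (2003), §3.1.2, §3.2.1 Thm. 3.16; §2.3.1–2.3.3; §6.2.1.
* [VoisinHodgeI2002] C. Voisin, Hodge Theory and Complex Algebraic Geometry I (2002), §9.2.1 Prop. 9.5.
* [ArnoldGuseinzadeVarchenko2012] V. I. Arnold, S. M. Gusein-Zade, A. N. Varchenko, Singularities of Differentiable Maps II (2012),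
  Part I §1.1–§1.3, §2.1, §2.3.
-/

noncomputable section

open CategoryTheory AlgebraicGeometry ContinuousMap TopologicalSpace Set Complex
open _root_.Topology
open scoped unitInterval LinearAlgebra.Projectivization Real
open Literature.AlgebraicTopology.SingularHomology Literature.Geometry.ComplexAnalytic
open Literature.AlgebraicGeometry.Motives Literature.AlgebraicGeometry.Motives.UniversalHypersurface
open Literature.AlgebraicGeometry.HodgeTheory.UniversalHypersurface Literature.NumberTheory.Transcendental

namespace Literature.AlgebraicGeometry.HodgeTheory

namespace WeightedPencil

set_option maxHeartbeats 800000 in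
/-- **The localisation package on the projective fibre from the geometric monodromy of a monomial pencil and its localisation
datum** (output shape H-A3LOC of `symmetricA3NonCommutation_of_localisedRotation`). See the module docstring for the data and the
construction. [cite: VoisinHodgeII2003, §3.1.2 and §3.2.1 Thm. 3.16] [cite: VoisinHodgeI2002, §9.2.1 Prop. 9.5]
[cite: ArnoldGuseinzadeVarchenko2012, Part I §1.3, §2.1 and §2.3] -/
theorem exists_localisationPackage_of_pencilMonodromy {n d : ℕ} {i : Fin (n + 2)} (hn : 1 ≤ n) (hd : 1 ≤ d)
    {ι : Type} [Fintype ι] (a : ι → ℕ) (b₀ : DegIndex n d → ℂ)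
    -- the geometric monodromy on the slice
    {δ₀ : ℝ} (h k : ℝ × NodalPencil.pencilSlice n d i b₀ → NodalPencil.pencilSlice n d i b₀)
    (hhc : Continuous fun ux : ℝ × {x : NodalPencil.pencilSlice n d i b₀ // NodalPencil.pencilCoord n d i b₀ x.1 ≠ 0} =>
      h (ux.1, ux.2.1))
    (hh0 : ∀ x, NodalPencil.pencilCoord n d i b₀ x.1 ≠ 0 → h (0, x) = x)
    (hhk : ∀ u x, NodalPencil.pencilCoord n d i b₀ x.1 ≠ 0 → ‖NodalPencil.pencilCoord n d i b₀ x.1‖ < δ₀ →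
      NodalPencil.pencilCoord n d i b₀ (h (u, x)).1 =
          Complex.exp (((2 * π * u : ℝ) : ℂ) * Complex.I) * NodalPencil.pencilCoord n d i b₀ x.1 ∧
        k (u, h (u, x)) = x ∧ h (u, k (u, x)) = x ∧
        NodalPencil.pencilCoord n d i b₀ (k (u, x)).1 =
          Complex.exp (((-(2 * π * u) : ℝ) : ℂ) * Complex.I) * NodalPencil.pencilCoord n d i b₀ x.1)
    -- the member and the loop
    {c : ℂ} (hc0 : c ≠ 0) (hcδ : ‖c‖ < δ₀)
    {s : ComplexPoints (base ℂ n d)} (hs : coeffVector ℂ n d s = b₀ + Pi.single (regPowIndex n d i) c) (γ : Path s s)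
    (hγ : ∀ u : I, coeffVector ℂ n d (γ u) =
      b₀ + Pi.single (regPowIndex n d i) (Complex.exp (((2 * π * (u : ℝ) : ℝ) : ℂ) * Complex.I) * c))
    -- the localisation datum on the member `X_c`
    {A B : Set ↥(NodalPencil.pencilFibre n d i b₀ c)} (hAo : IsOpen A) (hBo : IsOpen B) (hAB : A ∪ B = Set.univ)
    (κ : C(↥(NodalPencil.pencilFibre n d i b₀ c), ↥(NodalPencil.pencilFibre n d i b₀ c)))
    (hκ : ∀ y, ((κ y : ↥(NodalPencil.pencilFibre n d i b₀ c)) : ComplexPoints (regularTotal ℂ n d)) = (k (1, ⟨y.1, y.2.1⟩)).1)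
    (hκB : ∀ y ∈ B, κ y = y)
    (κA : C(↥A, ↥A)) (hκA : ∀ x, ((κA x : ↥A) : ↥(NodalPencil.pencilFibre n d i b₀ c)) = κ x.1)
    (e : C(↥A, ↥(PhamBrieskorn.fibre a)))
    (g : C(↥(PhamBrieskorn.fibre a), ↥(PhamBrieskorn.fibre a)))
    (hconj : (e.comp κA).Homotopic (g.comp e)) :
    ∃ (A' B' : Set (ComplexPoints (fiberOver (family ℂ n d) s))), IsOpen A' ∧ IsOpen B' ∧ A' ∪ B' = Set.univ ∧
      ∃ (η : ComplexPoints (fiberOver (family ℂ n d) s) ≃ₜ ComplexPoints (fiberOver (family ℂ n d) s))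
        (ηA : C(↥A', ↥A')) (r : ↥A' ≃ₜ ↥A),
        (∀ y ∈ B', η y = y) ∧ (∀ x : ↥A', ((ηA x : ↥A') : ComplexPoints (fiberOver (family ℂ n d) s)) = η x) ∧
        ((e.comp (r : C(↥A', ↥A))).comp ηA).Homotopic (g.comp (e.comp (r : C(↥A', ↥A)))) ∧
        ∀ (hU : IsCohomologicallyLocallyTrivialOn (family ℂ n d) Set.univ) (k' : ℕ)
          (T : bettiCohomology (fiberOver (family ℂ n d) s) k' ≃ₗ[ℚ] bettiCohomology (fiberOver (family ℂ n d) s) k'),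
          IsRatTransport (family ℂ n d) k' hU (loopClassUniv n d γ) T →
            ∀ x, T x = (singularCohomology.map ℚ ℚ
              (η : C(ComplexPoints (fiberOver (family ℂ n d) s), ComplexPoints (fiberOver (family ℂ n d) s))) k').hom x := by
  classical
  haveI : T2Space (ComplexPoints (regularTotal ℂ n d)) := t2Space_regularTotal n d
  set Zs : Set (ℙ ℂ (Fin (n + 2) → ℂ)) := Projectivization.projZeroLocus {pointForm ℂ n d s} with hZs
  let rot : ℝ → ℂ := fun u => Complex.exp (((2 * π * u : ℝ) : ℂ) * Complex.I)
  have hrot_neg : ∀ u : ℝ, Complex.exp (((-(2 * π * u) : ℝ) : ℂ) * Complex.I) * rot u = 1 := fun u => by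
    simp only [rot]
    rw [← Complex.exp_add]
    push_cast
    rw [show -(2 * (π : ℂ) * u) * Complex.I + 2 * π * u * Complex.I = 0 by ring, Complex.exp_zero]
  -- the sections `sX_t : Z_t → 𝒴°(ℂ)`
  choose sec hsXz hsXb hsXQ hsXy using fun t : ComplexPoints (base ℂ n d) => NodalPencil.exists_section_projZeroLocus n d hd t
  -- slice points from zero-set points
  have hγu : ∀ u : I, ∀ ℓ : {ℓ // ℓ ∈ Projectivization.projZeroLocus {pointForm ℂ n d (γ u)}},
      sec (γ u) ℓ ∈ NodalPencil.pencilSlice n d i b₀ ∧ NodalPencil.pencilCoord n d i b₀ (sec (γ u) ℓ) = rot u * c := fun u ℓ =>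
    NodalPencil.mem_pencilSlice_and_pencilCoord_eq_of_regCoeff_eq i b₀ (hγ u) (hsXb (γ u) ℓ)
  have hsl : ∀ ℓ : {ℓ // ℓ ∈ Zs}, sec s ℓ ∈ NodalPencil.pencilSlice n d i b₀ ∧ NodalPencil.pencilCoord n d i b₀ (sec s ℓ) = c :=
    fun ℓ => NodalPencil.mem_pencilSlice_and_pencilCoord_eq_of_regCoeff_eq i b₀ hs (hsXb s ℓ)
  have hrotc0 : ∀ u : ℝ, rot u * c ≠ 0 := fun u => mul_ne_zero (Complex.exp_ne_zero _) hc0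
  have hrotcδ : ∀ u : ℝ, ‖rot u * c‖ < δ₀ := fun u => by
    simp only [rot]; rw [norm_mul, Complex.norm_exp_ofReal_mul_I, one_mul]; exact hcδ
  let xs : {ℓ // ℓ ∈ Zs} → NodalPencil.pencilSlice n d i b₀ := fun ℓ => ⟨sec s ℓ, (hsl ℓ).1⟩
  let xu : ∀ u : I, {ℓ // ℓ ∈ Projectivization.projZeroLocus {pointForm ℂ n d (γ u)}} → NodalPencil.pencilSlice n d i b₀ :=
    fun u ℓ => ⟨sec (γ u) ℓ, (hγu u ℓ).1⟩
  have hxs0 : ∀ ℓ, NodalPencil.pencilCoord n d i b₀ (xs ℓ).1 ≠ 0 := fun ℓ => by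
    change NodalPencil.pencilCoord n d i b₀ (sec s ℓ) ≠ 0; rw [(hsl ℓ).2]; exact hc0
  have hxsδ : ∀ ℓ, ‖NodalPencil.pencilCoord n d i b₀ (xs ℓ).1‖ < δ₀ := fun ℓ => by
    change ‖NodalPencil.pencilCoord n d i b₀ (sec s ℓ)‖ < δ₀; rw [(hsl ℓ).2]; exact hcδ
  have hxu0 : ∀ u ℓ, NodalPencil.pencilCoord n d i b₀ (xu u ℓ).1 ≠ 0 := fun u ℓ => by
    change NodalPencil.pencilCoord n d i b₀ (sec (γ u) ℓ) ≠ 0; rw [(hγu u ℓ).2]; exact hrotc0 u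
  have hxuδ : ∀ u ℓ, ‖NodalPencil.pencilCoord n d i b₀ (xu u ℓ).1‖ < δ₀ := fun u ℓ => by
    change ‖NodalPencil.pencilCoord n d i b₀ (sec (γ u) ℓ)‖ < δ₀; rw [(hγu u ℓ).2]; exact hrotcδ u
  -- the projective isotopy
  let hP : I → ℙ ℂ (Fin (n + 2) → ℂ) → ℙ ℂ (Fin (n + 2) → ℂ) := fun u ℓ =>
    if hℓ : ℓ ∈ Zs then hypersurfacePoint (regularToProjectiveSpace ℂ n d) (h (u, xs ⟨ℓ, hℓ⟩)).1 else ℓ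
  let kP : I → ℙ ℂ (Fin (n + 2) → ℂ) → ℙ ℂ (Fin (n + 2) → ℂ) := fun u ℓ =>
    if hℓ : ℓ ∈ Projectivization.projZeroLocus {pointForm ℂ n d (γ u)} then
      hypersurfacePoint (regularToProjectiveSpace ℂ n d) (k (u, xu u ⟨ℓ, hℓ⟩)).1 else ℓ
  have hhP : ∀ (u : I) (ℓ : {ℓ // ℓ ∈ Zs}),
      hP u ℓ.1 = hypersurfacePoint (regularToProjectiveSpace ℂ n d) (h (u, xs ℓ)).1 := fun u ℓ => by
    simp only [hP, dif_pos ℓ.2]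
  have hkP : ∀ (u : I) (ℓ : {ℓ // ℓ ∈ Projectivization.projZeroLocus {pointForm ℂ n d (γ u)}}),
      kP u ℓ.1 = hypersurfacePoint (regularToProjectiveSpace ℂ n d) (k (u, xu u ℓ)).1 := fun u ℓ => by
    simp only [kP, dif_pos ℓ.2]
  have hhreg : ∀ (u : I) (ℓ : {ℓ // ℓ ∈ Zs}), regCoeff ℂ n d (h (u, xs ℓ)).1 = coeffVector ℂ n d (γ u) := by
    intro u ℓ
    obtain ⟨hpc, -, -, -⟩ := hhk u (xs ℓ) (hxs0 ℓ) (hxsδ ℓ)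
    refine NodalPencil.regCoeff_eq_coeffVector_of_pencilCoord_eq i b₀ (hγ u) (h (u, xs ℓ)).2 ?_
    rw [hpc]
    change rot u * NodalPencil.pencilCoord n d i b₀ (sec s ℓ) = rot u * c
    rw [(hsl ℓ).2]
  have hkreg : ∀ (u : I) (ℓ : {ℓ // ℓ ∈ Projectivization.projZeroLocus {pointForm ℂ n d (γ u)}}),
      regCoeff ℂ n d (k (u, xu u ℓ)).1 = coeffVector ℂ n d s := by
    intro u ℓ
    obtain ⟨-, -, -, hpk⟩ := hhk u (xu u ℓ) (hxu0 u ℓ) (hxuδ u ℓ)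
    refine NodalPencil.regCoeff_eq_coeffVector_of_pencilCoord_eq i b₀ hs (k (u, xu u ℓ)).2 ?_
    rw [hpk]
    change Complex.exp (((-(2 * π * (u : ℝ)) : ℝ) : ℂ) * Complex.I) * NodalPencil.pencilCoord n d i b₀ (sec (γ u) ℓ) = c
    rw [(hγu u ℓ).2, ← mul_assoc, hrot_neg, one_mul]
  -- the six hypotheses of the transport theorem
  have H1 : Continuous fun uy : I × {ℓ // ℓ ∈ Zs} => hP uy.1 uy.2.1 := by
    have hxsc : Continuous fun ℓ : {ℓ // ℓ ∈ Zs} =>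
        (⟨xs ℓ, hxs0 ℓ⟩ : {x : NodalPencil.pencilSlice n d i b₀ // NodalPencil.pencilCoord n d i b₀ x.1 ≠ 0}) :=
      (((sec s).continuous).subtype_mk _).subtype_mk _
    have hc : Continuous fun uy : I × {ℓ // ℓ ∈ Zs} =>
        hypersurfacePoint (regularToProjectiveSpace ℂ n d) (h ((uy.1 : ℝ), xs uy.2)).1 :=
      (continuous_hypersurfacePoint _).comp (continuous_subtype_val.comp
        (hhc.comp ((continuous_subtype_val.comp continuous_fst).prodMk (hxsc.comp continuous_snd))))
    refine hc.congr fun uy => ?_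
    exact (hhP uy.1 uy.2).symm
  have H2 : ∀ ℓ ∈ Zs, hP 0 ℓ = ℓ := fun ℓ hℓ => by
    rw [hhP 0 ⟨ℓ, hℓ⟩]
    change hypersurfacePoint _ (h ((0 : ℝ), xs ⟨ℓ, hℓ⟩)).1 = ℓ
    rw [hh0 (xs ⟨ℓ, hℓ⟩) (hxs0 _)]
    exact hsXz s ⟨ℓ, hℓ⟩
  have H3 : ∀ (u : I), ∀ ℓ ∈ Zs, hP u ℓ ∈ Projectivization.projZeroLocus {pointForm ℂ n d (γ u)} := fun u ℓ hℓ => by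
    rw [hhP u ⟨ℓ, hℓ⟩]
    exact NodalPencil.hypersurfacePoint_mem_projZeroLocus_of_regCoeff_eq n d (hhreg u ⟨ℓ, hℓ⟩)
  have H4 : ∀ (u : I), ∀ ℓ ∈ Projectivization.projZeroLocus {pointForm ℂ n d (γ u)}, kP u ℓ ∈ Zs := fun u ℓ hℓ => by
    rw [hkP u ⟨ℓ, hℓ⟩]
    exact NodalPencil.hypersurfacePoint_mem_projZeroLocus_of_regCoeff_eq n d (hkreg u ⟨ℓ, hℓ⟩)
  have H5 : ∀ (u : I), ∀ ℓ ∈ Zs, kP u (hP u ℓ) = ℓ := by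
    intro u ℓ hℓ
    have hmem := H3 u ℓ hℓ
    rw [hkP u ⟨hP u ℓ, hmem⟩]
    have hx' : xu u ⟨hP u ℓ, hmem⟩ = h (u, xs ⟨ℓ, hℓ⟩) := by
      apply Subtype.ext
      change sec (γ u) ⟨hP u ℓ, hmem⟩ = (h (u, xs ⟨ℓ, hℓ⟩)).1
      have key := hsXQ (γ u) (h (u, xs ⟨ℓ, hℓ⟩)).1 (hhreg u ⟨ℓ, hℓ⟩)
      have harg : (⟨hP u ℓ, hmem⟩ : {ℓ // ℓ ∈ Projectivization.projZeroLocus {pointForm ℂ n d (γ u)}}) =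
          ⟨hypersurfacePoint (regularToProjectiveSpace ℂ n d) (h (u, xs ⟨ℓ, hℓ⟩)).1,
            NodalPencil.hypersurfacePoint_mem_projZeroLocus_of_regCoeff_eq n d (hhreg u ⟨ℓ, hℓ⟩)⟩ :=
        Subtype.ext (hhP u ⟨ℓ, hℓ⟩)
      rw [harg]; exact key
    rw [hx', (hhk u (xs ⟨ℓ, hℓ⟩) (hxs0 _) (hxsδ _)).2.1]
    exact hsXz s ⟨ℓ, hℓ⟩
  have H6 : ∀ (u : I), ∀ ℓ ∈ Projectivization.projZeroLocus {pointForm ℂ n d (γ u)}, hP u (kP u ℓ) = ℓ := by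
    intro u ℓ hℓ
    have hmem := H4 u ℓ hℓ
    rw [hhP u ⟨kP u ℓ, hmem⟩]
    have hx' : xs ⟨kP u ℓ, hmem⟩ = k (u, xu u ⟨ℓ, hℓ⟩) := by
      apply Subtype.ext
      change sec s ⟨kP u ℓ, hmem⟩ = (k (u, xu u ⟨ℓ, hℓ⟩)).1
      have key := hsXQ s (k (u, xu u ⟨ℓ, hℓ⟩)).1 (hkreg u ⟨ℓ, hℓ⟩)
      have harg : (⟨kP u ℓ, hmem⟩ : {ℓ // ℓ ∈ Zs}) =
          ⟨hypersurfacePoint (regularToProjectiveSpace ℂ n d) (k (u, xu u ⟨ℓ, hℓ⟩)).1,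
            NodalPencil.hypersurfacePoint_mem_projZeroLocus_of_regCoeff_eq n d (hkreg u ⟨ℓ, hℓ⟩)⟩ :=
        Subtype.ext (hkP u ⟨ℓ, hℓ⟩)
      rw [harg]; exact key
    rw [hx', (hhk u (xu u ⟨ℓ, hℓ⟩) (hxu0 _ _) (hxuδ _ _)).2.2.1]
    exact hsXz (γ u) ⟨ℓ, hℓ⟩
  -- the homeomorphism `Z_s ≃ₜ X_c`
  obtain ⟨τ₀, hτ₀, hτ₀s⟩ := NodalPencil.exists_homeomorph_projZeroLocus_setOf_regCoeff_eq n d hn hd s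
  have hXeq := NodalPencil.setOf_regCoeff_eq_eq_pencilFibre i b₀ hs
  let τ : {ℓ // ℓ ∈ Zs} ≃ₜ ↥(NodalPencil.pencilFibre n d i b₀ c) := τ₀.trans (Homeomorph.setCongr hXeq)
  have hτ : ∀ ℓ, hypersurfacePoint (regularToProjectiveSpace ℂ n d) (τ ℓ).1 = ℓ.1 := fun ℓ => hτ₀ ℓ
  have hτs : ∀ y : ↥(NodalPencil.pencilFibre n d i b₀ c), (τ.symm y).1 = hypersurfacePoint (regularToProjectiveSpace ℂ n d) y.1 := fun y =>
    hτ₀s ⟨y.1, by rw [hXeq]; exact y.2⟩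
  -- `κ` read on `Z_s` is `kP 1`
  have hκZ : ∀ ℓ : {ℓ // ℓ ∈ Zs}, (τ.symm (κ (τ ℓ))).1 = kP 1 ℓ.1 := by
    intro ℓ
    rw [hτs, hκ]
    have hmem1 : ℓ.1 ∈ Projectivization.projZeroLocus {pointForm ℂ n d (γ 1)} := by rw [γ.target]; exact ℓ.2
    rw [hkP 1 ⟨ℓ.1, hmem1⟩]
    have hx : xu 1 ⟨ℓ.1, hmem1⟩ = ⟨(τ ℓ).1, (τ ℓ).2.1⟩ := by
      apply Subtype.ext
      change sec (γ 1) ⟨ℓ.1, hmem1⟩ = (τ ℓ).1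
      have hreg : regCoeff ℂ n d (τ ℓ).1 = coeffVector ℂ n d (γ 1) := by
        rw [γ.target]
        exact NodalPencil.regCoeff_eq_coeffVector_of_pencilCoord_eq i b₀ hs (τ ℓ).2.1 (τ ℓ).2.2
      have key := hsXQ (γ 1) (τ ℓ).1 hreg
      have harg : (⟨hypersurfacePoint (regularToProjectiveSpace ℂ n d) (τ ℓ).1,
          NodalPencil.hypersurfacePoint_mem_projZeroLocus_of_regCoeff_eq n d hreg⟩ :
            {ℓ // ℓ ∈ Projectivization.projZeroLocus {pointForm ℂ n d (γ 1)}}) = ⟨ℓ.1, hmem1⟩ :=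
        Subtype.ext (hτ ℓ)
      rw [harg] at key
      exact key
    rw [hx, Set.Icc.coe_one]
  -- the projective fibre `Y_s(ℂ) ≃ₜ Z_s ≃ₜ X_c`
  obtain ⟨es, hes⟩ := exists_homeomorph_fibrePoint (n := n) hd s
  let sX : ComplexPoints (fiberOver (family ℂ n d) s) ≃ₜ ↥(NodalPencil.pencilFibre n d i b₀ c) := es.trans τ
  -- the monodromy homeomorphism `η = sX⁻¹ ∘ κ ∘ sX` of `Y_s(ℂ)`: first as a continuous map, then as a homeomorphism (the
  -- restriction of `h(1, ·)` to the compact Hausdorff `X_c` is a homeomorphism with inverse `κ`)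
  haveI : CompactSpace ↥(NodalPencil.pencilFibre n d i b₀ c) := isCompact_iff_compactSpace.mp (NodalPencil.isCompact_pencilFibre_of_coeffVector_eq i b₀ hn hd hs)
  have h2π : Complex.exp (((2 * π * (1 : ℝ) : ℝ) : ℂ) * Complex.I) = 1 := by
    rw [mul_one, show (((2 * π : ℝ)) : ℂ) * Complex.I = 2 * π * Complex.I by push_cast; ring]
    exact Complex.exp_two_pi_mul_I
  have hgoodc : ∀ y : ↥(NodalPencil.pencilFibre n d i b₀ c), NodalPencil.pencilCoord n d i b₀ y.1 ≠ 0 ∧ ‖NodalPencil.pencilCoord n d i b₀ y.1‖ < δ₀ := fun y => by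
    rw [y.2.2]; exact ⟨hc0, hcδ⟩
  have hmemY : ∀ y : ↥(NodalPencil.pencilFibre n d i b₀ c), (h (1, ⟨y.1, y.2.1⟩)).1 ∈ NodalPencil.pencilFibre n d i b₀ c := fun y =>
    ⟨(h (1, ⟨y.1, y.2.1⟩)).2, by
      rw [(hhk 1 ⟨y.1, y.2.1⟩ (hgoodc y).1 (hgoodc y).2).1, h2π, one_mul]; exact y.2.2⟩
  let toS : ↥(NodalPencil.pencilFibre n d i b₀ c) → {x : NodalPencil.pencilSlice n d i b₀ // NodalPencil.pencilCoord n d i b₀ x.1 ≠ 0} :=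
    fun y => ⟨⟨y.1, y.2.1⟩, (hgoodc y).1⟩
  have htoS : Continuous toS := (continuous_subtype_val.subtype_mk _).subtype_mk _
  let hX : C(↥(NodalPencil.pencilFibre n d i b₀ c), ↥(NodalPencil.pencilFibre n d i b₀ c)) := ⟨fun y => ⟨(h (1, ⟨y.1, y.2.1⟩)).1, hmemY y⟩,
    (continuous_subtype_val.comp ((hhc.comp (continuous_const.prodMk continuous_id)).comp htoS)).subtype_mk _⟩
  have hXval : ∀ y, ((hX y : ↥(NodalPencil.pencilFibre n d i b₀ c)) : ComplexPoints (regularTotal ℂ n d)) = (h (1, ⟨y.1, y.2.1⟩)).1 := fun y => rfl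
  have hκh : ∀ y, κ (hX y) = y := fun y => by
    apply Subtype.ext
    rw [hκ]
    have hmk : (⟨(hX y).1, (hX y).2.1⟩ : NodalPencil.pencilSlice n d i b₀) = h (1, ⟨y.1, y.2.1⟩) := Subtype.ext (hXval y)
    rw [hmk, (hhk 1 ⟨y.1, y.2.1⟩ (hgoodc y).1 (hgoodc y).2).2.1]
  have hhκ : ∀ y, hX (κ y) = y := fun y => by
    apply Subtype.ext
    rw [hXval]
    have hmk : (⟨(κ y).1, (κ y).2.1⟩ : NodalPencil.pencilSlice n d i b₀) = k (1, ⟨y.1, y.2.1⟩) := Subtype.ext (hκ y)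
    rw [hmk, (hhk 1 ⟨y.1, y.2.1⟩ (hgoodc y).1 (hgoodc y).2).2.2.1]
  let hXe : ↥(NodalPencil.pencilFibre n d i b₀ c) ≃ ↥(NodalPencil.pencilFibre n d i b₀ c) := ⟨hX, κ, hκh, hhκ⟩
  let hXh : ↥(NodalPencil.pencilFibre n d i b₀ c) ≃ₜ ↥(NodalPencil.pencilFibre n d i b₀ c) := Continuous.homeoOfEquivCompactToT2 (f := hXe) hX.continuous
  have hXh_symm : ∀ y, hXh.symm y = κ y := fun _ => rfl
  let η : ComplexPoints (fiberOver (family ℂ n d) s) ≃ₜ ComplexPoints (fiberOver (family ℂ n d) s) :=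
    sX.trans (hXh.symm.trans sX.symm)
  have hη : ∀ y, η y = sX.symm (κ (sX y)) := fun _ => rfl
  have hsXη : ∀ y, sX (η y) = κ (sX y) := fun y => by rw [hη, Homeomorph.apply_symm_apply]
  -- the open cover of `Y_s(ℂ)`
  let A' : Set (ComplexPoints (fiberOver (family ℂ n d) s)) := sX ⁻¹' A
  let B' : Set (ComplexPoints (fiberOver (family ℂ n d) s)) := sX ⁻¹' B
  have hA'o : IsOpen A' := hAo.preimage sX.continuous
  have hB'o : IsOpen B' := hBo.preimage sX.continuous
  have hA'B' : A' ∪ B' = Set.univ := by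
    ext y
    simp only [A', B', Set.mem_union, Set.mem_preimage, Set.mem_univ, iff_true]
    have : sX y ∈ A ∪ B := by rw [hAB]; exact Set.mem_univ _
    exact this
  have hηB : ∀ y ∈ B', η y = y := fun y hy => by
    apply sX.injective
    rw [hsXη, hκB _ hy]
  -- the restriction of `η` to `A'` and the chart `e ∘ r`
  have hmapsA : ∀ x : ↥A', η x.1 ∈ A' := fun x => by
    change sX (η x.1) ∈ A
    rw [hsXη, ← hκA ⟨sX x.1, x.2⟩]
    exact (κA ⟨sX x.1, x.2⟩).2
  let ηA : C(↥A', ↥A') := ⟨fun x => ⟨η x.1, hmapsA x⟩, (η.continuous.comp continuous_subtype_val).subtype_mk _⟩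
  let r : ↥A' ≃ₜ ↥A := sX.sets rfl
  have hr : ∀ x : ↥A', ((r x : ↥A) : ↥(NodalPencil.pencilFibre n d i b₀ c)) = sX x.1 := fun _ => rfl
  have hrconj : (r : C(↥A', ↥A)).comp ηA = κA.comp (r : C(↥A', ↥A)) := by
    refine ContinuousMap.ext fun x => Subtype.ext ?_
    change sX (η x.1) = ((κA (r x) : ↥A) : ↥(NodalPencil.pencilFibre n d i b₀ c))
    rw [hsXη, hκA, hr]
  have hconj' : ((e.comp (r : C(↥A', ↥A))).comp ηA).Homotopic (g.comp (e.comp (r : C(↥A', ↥A)))) := by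
    have h1 : (e.comp (r : C(↥A', ↥A))).comp ηA = (e.comp κA).comp (r : C(↥A', ↥A)) := by
      rw [ContinuousMap.comp_assoc, hrconj, ← ContinuousMap.comp_assoc]
    have h2 : g.comp (e.comp (r : C(↥A', ↥A))) = (g.comp e).comp (r : C(↥A', ↥A)) := by
      rw [← ContinuousMap.comp_assoc]
    rw [h1, h2]
    exact hconj.comp (ContinuousMap.Homotopic.refl _)
  refine ⟨A', B', hA'o, hB'o, hA'B', η, ηA, r, hηB, fun x => rfl, hconj', ?_⟩
  -- the transport: the monodromy homeomorphism of the projective isotopy has inverse reading `kP 1`, i.e. it is `η`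
  intro hU k' T hT x
  obtain ⟨η', -, hη's, hT', hTv'⟩ := exists_homeomorph_isRatTransport_of_isotopy hn hd hU γ hP kP H1 H2 H3 H4 H5 H6
  -- `η'⁻¹ = η`
  have hηeq : ∀ y, η'.symm y = η y := by
    intro y
    apply fibrePoint_injective s
    rw [hη's, ← hes, ← hes]
    change kP 1 (es y).1 = (es (sX.symm (κ (sX y)))).1
    change _ = (es (es.symm (τ.symm (κ (τ (es y)))))).1
    rw [Homeomorph.apply_symm_apply, hκZ]
  have hηC : (η'.symm : C(ComplexPoints (fiberOver (family ℂ n d) s), ComplexPoints (fiberOver (family ℂ n d) s))) = (η : C(ComplexPoints (fiberOver (family ℂ n d) s), ComplexPoints (fiberOver (family ℂ n d) s))) := ContinuousMap.ext hηeq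
  -- uniqueness of the rational transport along `γ`
  have hTT : T = (singularCohomology.mapIso ℚ ℚ η'.symm k').toLinearEquiv :=
    LinearEquiv.ext fun v => ofRatClass_injective k' ((hT v).trans ((hT' k') v).symm)
  rw [hTT, hTv' k' x, hηC]

end WeightedPencil

end Literature.AlgebraicGeometry.HodgeTheory

end
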